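import Summits.QuantumFields.YangMills.Theorems.UniversalDetectorMirrorPositivity
import Summits.QuantumFields.YangMills.Theorems.UniversalDetectorTorusPeriodicity
import Summits.QuantumFields.YangMills.Theorems.UniversalDetectorQ2ThetaReindex

/-!
# Route `UniversalDetector`, support item `PlaneLimitExtraction` (stmt-QuantumFields-23251) — the lattice
reflection-positivity inequality for `Q2(ϑw, w)` up to the reflected-density defect

Ideator seat ym-idea-8 g7 (LINE 4 of rung R2a = `BalabanLadder.NT`).  Assembly of the lattice side of the
reflection-positivity clause: for a real Schwartz weight `w` carried by the time slab `t₀ ≤ y₀ ≤ T` (`t₀ > 0`), on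
the odd torus `2L+1` with `T + 2s ≤ sL` and `β ≥ 0`,

  `Q2 β L s (ϑw) w ≥ -36 · E · (Σ_{x ∈ box} |w(s x)|)²`

where `E` is any common bound for the one-step time differences of the 36 plane-resolved truncated kernels at the
reflected charged pairs (`Q2_thetaTest_ge_neg_defect`).  Ingredients: `Q2(ϑw,w)` is the reflected-pair sum
(`Q2_thetaTest_eq`), restricted to the charged window (`sum_box_mul_mul_eq_sum_filter`, `slab_window`); the mirror
form is `≥ 0` by reflection positivity of the Wilson measure for the site reflection
(`torusCov_cfgReflect_densSum_nonneg`); the two differ by at most `Σ|c||c|ΣΣE = 36E(Σ|c|)²`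
(`abs_riemannMirror_sub_mirrorCov_le`, `sum_abs_mul_abs_mul_const`).  With `E = s⁸ ω(s)` from (TIGHT6) and the
uniform Riemann bound `s⁴ Σ|w(s x)| ≤ B_w` the right side is `-36 ω(s) B_w² → 0`, which is the `-δ_k` of
`integral_nonneg_of_Q2_ge_neg`.  No summit, rung or crux is proved here.
-/

set_option autoImplicit false

noncomputable section

open scoped SchwartzMap
open MeasureTheory Filter Topology Finset
open Literature.MathematicalPhysics.QuantumFieldTheory Literature.MathematicalPhysics.QuantumLattice
  Literature.Probability.LatticeModels
open Summit.QuantumFields.YangMills.Cruxes.OSLegsFromFemtoAndGap.DlrCollarTransfer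

namespace Summit.QuantumFields.YangMills.Cruxes.UniversalDetectorPlaneTight

variable {G : Type} [Group G] [TopologicalSpace G] [IsTopologicalGroup G] [CompactSpace G]
  [MeasurableSpace G] [BorelSpace G] (r : LatticeRep G)

/-- **Lattice reflection positivity for `Q2(ϑw, w)` up to the reflected-density defect.**  If every one-step time
difference of the plane-resolved truncated kernels at the reflected charged pairs is bounded by `E ≥ 0`, then
`-36 E (Σ_{x ∈ box} |w(s x)|)² ≤ Q2 β L s (ϑw) w`. -/
theorem Q2_thetaTest_ge_neg_defect {β : ℝ} (hβ : 0 ≤ β) {L : ℕ} (hL : 1 ≤ L) {s t₀ T : ℝ} (hs : 0 < s)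
    (ht₀ : 0 < t₀) (hTL : T + 2 * s ≤ s * L) (w : 𝓢(EuclideanSpace ℝ (Fin 4), ℝ))
    (hw : tsupport (w : EuclideanSpace ℝ (Fin 4) → ℝ) ⊆ {y | t₀ ≤ y 0 ∧ y 0 ≤ T}) {E : ℝ} (hE : 0 ≤ E)
    (hstep : ∀ x ∈ box 4 L, ∀ y ∈ box 4 L, t₀ ≤ s * (x 0 : ℝ) → s * (x 0 : ℝ) ≤ T →
      t₀ ≤ s * (y 0 : ℝ) → s * (y 0 : ℝ) ≤ T → ∀ p q : {q : Fin 4 × Fin 4 // q.1 < q.2},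
      |(torusE G r β L (fun V => plane G r p.1 0 V * plane G r q.1 (siteReflect x - y) V) -
          torusE G r β L (plane G r p.1 0) * torusE G r β L (plane G r q.1 (siteReflect x - y))) -
        (torusE G r β L (fun V => plane G r p.1 0 V *
            plane G r q.1 ((if q.1.1 = 0 then siteReflect x - Pi.single 0 1 else siteReflect x) - y) V) -
          torusE G r β L (plane G r p.1 0) *
            torusE G r β L (plane G r q.1 ((if q.1.1 = 0 then siteReflect x - Pi.single 0 1 else siteReflect x) - y)))|
        ≤ E) :
    -(36 * E * (∑ x ∈ box 4 L, |w (s • siteToE x)|) ^ 2) ≤ Q2 G r β L s (thetaTest 4 w) w := by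
  classical
  let P : Site 4 → Prop := fun x => t₀ ≤ s * (x 0 : ℝ) ∧ s * (x 0 : ℝ) ≤ T
  let c : Site 4 → ℝ := fun x => w (s • siteToE x)
  have hc0 : ∀ x ∈ box 4 L, ¬ P x → c x = 0 := by
    intro x _ hPx
    by_contra hne
    have hmem : s • siteToE x ∈ tsupport (w : EuclideanSpace ℝ (Fin 4) → ℝ) :=
      subset_tsupport _ (Function.mem_support.2 hne)
    have h := hw hmem
    simp only [Set.mem_setOf_eq, PiLp.smul_apply, siteToE_apply, smul_eq_mul] at h
    exact hPx h
  have hQ : Q2 G r β L s (thetaTest 4 w) w = ∑ x ∈ (box 4 L).filter P, ∑ y ∈ (box 4 L).filter P, c x * c y *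
      (torusE G r β L (fun V => dens G r y V * dens G r (siteReflect x) V) -
        torusE G r β L (dens G r y) * torusE G r β L (dens G r (siteReflect x))) := by
    rw [Q2_thetaTest_eq]
    exact sum_box_mul_mul_eq_sum_filter L c (fun x y =>
      torusE G r β L (fun V => dens G r y V * dens G r (siteReflect x) V) -
        torusE G r β L (dens G r y) * torusE G r β L (dens G r (siteReflect x))) P hc0
  have hXwin : ∀ x ∈ (box 4 L).filter P, 0 ≤ x 0 ∧ x 0 + 2 ≤ (L : ℤ) := fun x hx => by
    have hPx := (Finset.mem_filter.1 hx).2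
    exact slab_window hs ht₀ hTL hPx.1 hPx.2
  have hM := torusCov_cfgReflect_densSum_nonneg r hβ hL ((box 4 L).filter P) c hXwin
  have hR := abs_riemannMirror_sub_mirrorCov_le r β L ((box 4 L).filter P) c (fun _ _ _ _ => E)
    (fun x hx y hy p q => by
      have hPx := (Finset.mem_filter.1 hx).2
      have hPy := (Finset.mem_filter.1 hy).2
      exact hstep x (Finset.mem_filter.1 hx).1 y (Finset.mem_filter.1 hy).1 hPx.1 hPx.2 hPy.1 hPy.2 p q)
  rw [sum_abs_mul_abs_mul_const] at hR
  have h1 : ∑ x ∈ (box 4 L).filter P, |c x| ≤ ∑ x ∈ box 4 L, |c x| :=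
    Finset.sum_le_sum_of_subset_of_nonneg (Finset.filter_subset _ _) fun _ _ _ => abs_nonneg _
  have h0 : 0 ≤ ∑ x ∈ (box 4 L).filter P, |c x| := Finset.sum_nonneg fun _ _ => abs_nonneg _
  have hXle : (∑ x ∈ (box 4 L).filter P, |c x|) ^ 2 ≤ (∑ x ∈ box 4 L, |c x|) ^ 2 := pow_le_pow_left₀ h0 h1 2
  have hR' := (abs_le.1 hR).1
  rw [hQ]
  have h36 : 36 * E * (∑ x ∈ (box 4 L).filter P, |c x|) ^ 2 ≤ 36 * E * (∑ x ∈ box 4 L, |c x|) ^ 2 :=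
    mul_le_mul_of_nonneg_left hXle (by positivity)
  linarith

end Summit.QuantumFields.YangMills.Cruxes.UniversalDetectorPlaneTight

end
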